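import Summits.NavierStokesRegularity.NavierStokesRegularity.Theorems.FilamentSkeletonRssCoreGluingSplit
import Summits.NavierStokesRegularity.NavierStokesRegularity.Theorems.FilamentSkeletonRssCoreGluingInvertibilitySplit
import Summits.NavierStokesRegularity.NavierStokesRegularity.Theorems.FilamentSkeletonRssCoreGluingRouteReduction
import Summits.NavierStokesRegularity.NavierStokesRegularity.Theorems.FilamentSkeletonRssCoreGluingVacuous

/-!
# Crux `CoreGluing` (stmt-NavierStokesRegularity-15401) — lead c12: typed rev-6 restatement menu (workfile, evidence)

Route rev 5 (judge repair, 2026-08-17T08:59Z) split the crux into `CoreLinearInvertibility` (stmt-17973, the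
linear planar core lemma) and `CoreGluingGivenInvertibility := CoreLinearInvertibility → CoreGluing`
(stmt-17944).  The second child still consumes the idle all-τ `SkeletonEquilibrium`, so it is
`CoreLinearInvertibility → (¬ SkeletonEquilibrium ∨ RssProfileExists)` (Theorems.coreGluingGivenInvertibility_iff,
p151377) — provable only by refuting stmt-15400 or by proving the target outright, exactly like the parent
(leads c2–c11).  The crux-strategist's prepared split (Cruxes/CoreGluing/SPLIT-s1.md, certified glue
`CoreGluingSplitGlue.lean`) supplies the QUANTITATIVE hypothesis a gluing theorem can consume.  This file
types the combination of the two and kernel-checks the glue: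

* `SelectionBox`, `TransverseReduction` — s1 children verbatim (statements from SPLIT-s1 §2 children.json);
* `CoreGluingGivenInvertibilityQ := CoreLinearInvertibility → TransverseReduction` — the proposed rev-6
  statement of stmt-17944 (the nonlinear 3-D gluing modulo the N accretion modes GIVEN the linear input,
  with the ball-exact quantitative skeleton box as hypothesis instead of `SkeletonEquilibrium`);
* glue, all proved here from the LANDED s1 glue (`Theorems.stub_coreGluingSplit` / `rssProfileExists_of_selectionBox_transverseReduction`, p153006) and tree theorems:
  `coreGluing_of_rev6 : SelectionBox → CoreGluingGivenInvertibilityQ → CoreLinearInvertibility → CoreGluing`,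
  `coreGluingGivenInvertibility_of_rev6 : SelectionBox → CoreGluingGivenInvertibilityQ → CoreGluingGivenInvertibility`
  (the rev-6 item implies the rev-5 item, so restating 17944 loses nothing),
  `closes_rev6 : SelectionBox → CoreLinearInvertibility → CoreGluingGivenInvertibilityQ → RdssProfileTruncation → ¬NS`
  (in fact the bridge is not even needed: `rssProfileExists_not_navierStokesRegularity`, p134409).

Planner commands this enables (tenure planner / judge): `ledger route edit route-NavierStokesRegularity-FilamentSkeletonRss
--restate CoreGluingGivenInvertibility --statement @<CoreLinearInvertibility → TransverseReduction text>` plus a new crux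
`SelectionBox` (children.json of SPLIT-s1, entry 1) and `--closes-file` with `closes_rev6`'s body; then `SkeletonEquilibrium`
(all-τ, very probably false: Cruxes/SkeletonEquilibrium) and `CoreGluing` become `aside` (their defs must stay: 27 Theorems
files reference them).
-/

set_option linter.dupNamespace false

noncomputable section

namespace Summit.NavierStokesRegularity.NavierStokesRegularity.Cruxes.CoreGluing.RestatementC12

open scoped BigOperators Topology Manifold Classical MeasureTheory ProbabilityTheory Matrix InnerProductSpace ComplexConjugate ContinuousMap
open Filter Set Function TopologicalSpace MeasureTheory
open Summit.NavierStokesRegularity.NavierStokesRegularity.Theses.FilamentSkeletonRss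
open Summit.NavierStokesRegularity.NavierStokesRegularity.Theorems

/-- s1 child 1 (`SelectionBox`), statement verbatim from SPLIT-s1 §2 children.json: an N-parameter box of
ball-exact quantitative filament skeletons (K1-ball as an N-box) + the accretion sign law. -/
def SelectionBox : Prop :=
  ∃ (N : ℕ) (δ ρ K Λ a b cnd η Rw Rb cg Γ₂ : ℝ), 0 < N ∧ 0 < δ ∧ 0 < ρ ∧ 0 < cnd ∧ 0 < η ∧ 0 < Rw ∧ 0 < Rb ∧ 0 < cg ∧ ∀ Γ : ℝ, Γ₂ ≤ Γ → ∃ (γ : (Fin N → ℝ) → Fin N → ℝ) (α : (Fin N → ℝ) → ℝ) (X : (Fin N → ℝ) → Fin N → ℝ → EuclideanSpace ℝ (Fin 3)) (w : (Fin N → ℝ) → Fin N → ℝ → ℝ) (c : (Fin N → ℝ) → Fin N → ℝ) (m n : (Fin N → ℝ) → Fin N → EuclideanSpace ℝ (Fin 3)), ∀ (u : (Fin N → ℝ) → (Fin N → ℝ → EuclideanSpace ℝ (Fin 3)) → EuclideanSpace ℝ (Fin 3) → EuclideanSpace ℝ (Fin 3)) (v : (Fin N → ℝ) → EuclideanSpace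 ℝ (Fin 3) → EuclideanSpace ℝ (Fin 3)) (A : (Fin N → ℝ) → Fin N → (EuclideanSpace ℝ (Fin 3) →L[ℝ] EuclideanSpace ℝ (Fin 3))) (T : (Fin N → ℝ) → (Fin N → ℝ → EuclideanSpace ℝ (Fin 3)) → Fin N → ℝ → EuclideanSpace ℝ (Fin 3)) (D : (Fin N → ℝ) → Fin N → EuclideanSpace ℝ (Fin 3) → EuclideanSpace ℝ (Fin 3)), (∀ p Z y, u p Z y = ∑ k : Fin N, (Γ * γ p k / (4 * Real.pi)) • ∫ σ : ℝ, ((‖y - Z k σ‖ ^ 2 + 1) ^ (3 / 2 : ℝ))⁻¹ • Literature.Analysis.FluidPDE.cross (deriv (Z k) σ) (y - Z k σ)) → (∀ p y, v p y = u p (X p) y + (1 / 2 : ℝ) • y - α p • Literature.Analysis.FluidPDE.cross (EuclideanSpace.single (2 : Fin 3) (1 : ℝ)) y) → (∀ p j, A p j = fderiv ℝ (v p) (X p j (c p j))) → (∀ p Z j τ, T p Z j τ = (u p Z (Z j τ) + (1 / 2 : ℝ) • Z j τ - α p • Literature.Analysis.FluidPDE.cross (EuclideanSpace.single (2 : Fin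 3) (1 : ℝ)) (Z j τ)) - (inner ℝ (u p Z (Z j τ) + (1 / 2 : ℝ) • Z j τ - α p • Literature.Analysis.FluidPDE.cross (EuclideanSpace.single (2 : Fin 3) (1 : ℝ)) (Z j τ)) (deriv (Z j) τ) / ‖deriv (Z j) τ‖ ^ 2) • deriv (Z j) τ) → (∀ p j y, D p j y = (Real.exp (-(inner ℝ (y - X p j (c p j)) (deriv (X p j) (c p j))) ^ 2) * ((1 - Real.exp (-(‖y - X p j (c p j)‖ ^ 2 - inner ℝ (y - X p j (c p j)) (deriv (X p j) (c p j)) ^ 2))) / (‖y - X p j (c p j)‖ ^ 2 - inner ℝ (y - X p j (c p j)) (deriv (X p j) (c p j)) ^ 2))) • Literature.Analysis.FluidPDE.cross (deriv (X p j) (c p j)) (y - X p j (c p j))) → ((∀ j, ContinuousOn (fun q : (Fin N → ℝ) × ℝ => (α q.1, γ q.1 j, X q.1 j q.2, w q.1 j q.2)) ({p : Fin N → ℝ | ∀ i, p i ∈ Set.Icc (0:ℝ) 1} ×ˢ Set.univ)) ∧ (∀ p : Fin N → ℝ, (∀ i, p i ∈ Set.Icc (0:ℝ) 1) → α p ≠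 0 ∧ (∀ j, γ p j ≠ 0) ∧ (∀ j, ContDiff ℝ 2 (X p j) ∧ Differentiable ℝ (w p j) ∧ (∀ τ, ‖deriv (X p j) τ‖ = 1) ∧ (∀ τ, ‖iteratedDeriv 2 (X p j) τ‖ * Real.sqrt Γ ≤ K) ∧ Filter.Tendsto (fun τ => ‖X p j τ‖) (Filter.cocompact ℝ) Filter.atTop) ∧ (∀ j k, j ≠ k → ∀ τ σ, ρ * Real.sqrt Γ ≤ ‖X p j τ - X p k σ‖) ∧ (∀ j τ σ, ρ * Real.sqrt Γ ≤ |τ - σ| → cg * ρ * Real.sqrt Γ ≤ ‖X p j τ - X p j σ‖) ∧ (∀ j τ, cg * |τ - c p j| ≤ Rw * Real.sqrt Γ + ‖X p j τ‖) ∧ (∀ j τ, w p j τ = inner ℝ (v p (X p j τ)) (deriv (X p j) τ)) ∧ (∀ j τ, ‖X p j τ‖ ≤ Rb * Real.sqrt (Γ * Real.log Γ) → v p (X p j τ) = w p j τ • deriv (X p j) τ) ∧ (∀ j, ‖X p j (c p j)‖ ≤ Rw * Real.sqrt Γ) ∧ (∀ j, w p j (c p j) = 0 ∧ (∀ τ,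 w p j τ = 0 → τ = c p j) ∧ 3 / 2 + δ ≤ deriv (w p j) (c p j) ∧ deriv (w p j) (c p j) ≤ Λ) ∧ (∀ j, Orthonormal ℝ ![deriv (X p j) (c p j), m p j, n p j] ∧ inner ℝ (A p j (m p j)) (m p j) + inner ℝ (A p j (n p j)) (n p j) < 0 ∧ inner ℝ (A p j (n p j)) (m p j) * inner ℝ (A p j (m p j)) (n p j) < inner ℝ (A p j (m p j)) (m p j) * inner ℝ (A p j (n p j)) (n p j)) ∧ (∀ Y : Fin N → ℝ → EuclideanSpace ℝ (Fin 3), (∀ j, ContDiff ℝ 2 (Y j)) → (∀ j τ, inner ℝ (Y j τ) (deriv (X p j) τ) = 0) → ∑ j : Fin N, inner ℝ (Y j (c p j)) (Literature.Analysis.FluidPDE.cross (EuclideanSpace.single (2 : Fin 3) (1 : ℝ)) (X p j (c p j))) = 0 → (∀ j τ, ‖Y j τ‖ + ‖deriv (Y j) τ‖ + ‖iteratedDeriv 2 (Y j) τ‖ ≤ (1 + |τ - c p j|) ^ b) → ∀ L : ℝ, (∀ j τ, ‖deriv (fun s : ℝ => T p (fun k σ => X p k σ + s • Y k σ) j τ)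 0‖ ≤ L * (1 + |τ - c p j|) ^ a) → ∀ j τ, ‖Y j τ‖ ≤ cnd * L * (1 + |τ - c p j|) ^ b))) ∧ (∀ (C₀ M : ℝ) (U : (Fin N → ℝ) → EuclideanSpace ℝ (Fin 3) → EuclideanSpace ℝ (Fin 3)) (P : (Fin N → ℝ) → EuclideanSpace ℝ (Fin 3) → ℝ) (B : (Fin N → ℝ) → Fin N → ℝ), (ContinuousOn B {p : Fin N → ℝ | ∀ i, p i ∈ Set.Icc (0:ℝ) 1} ∧ ∀ p : Fin N → ℝ, (∀ i, p i ∈ Set.Icc (0:ℝ) 1) → U p ≠ 0 ∧ ContDiff ℝ (⊤ : ℕ∞) (U p) ∧ ContDiff ℝ (⊤ : ℕ∞) (P p) ∧ Literature.Analysis.FluidPDE.VectorCalculus.IsDivFree (U p) ∧ (∀ y, α p • (Literature.Analysis.FluidPDE.cross (EuclideanSpace.single (2 : Fin 3) (1 : ℝ)) (U p y) - fderiv ℝ (U p) y (Literature.Analysis.FluidPDE.cross (EuclideanSpace.single (2 : Fin 3) (1 : ℝ)) y)) + (1 / 2 : ℝ) • U p y + (1 / 2 : ℝ) • fderiv ℝ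 (U p) y y - (Laplacian.laplacian (U p)) y + fderiv ℝ (U p) y (U p y) + gradient (P p) y = ∑ j : Fin N, B p j • D p j y) ∧ (∀ y, ‖U p y‖ ≤ C₀ / (1 + ‖y‖)) ∧ (∀ y, |P p y| ≤ M) ∧ (∀ y, ‖y‖ ≤ Rw * Real.sqrt Γ → (∀ j τ, ρ * Real.sqrt Γ / 4 ≤ ‖y - X p j τ‖) → ‖U p y - u p (X p) y‖ ≤ η * Real.sqrt Γ)) → (∀ (j : Fin N) (p q : Fin N → ℝ), (∀ i, p i ∈ Set.Icc (0:ℝ) 1) → (∀ i, q i ∈ Set.Icc (0:ℝ) 1) → p j = 0 → q j = 1 → B p j * B q j < 0))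

/-- s1 child 2 (`TransverseReduction`), statement verbatim from SPLIT-s1 §2 children.json: every skeleton box
with the clauses of `SelectionBox` (conjuncts 1–2) carries a continuous reduced profile family modulo the N
accretion modes (the leads' K2q). -/
def TransverseReduction : Prop :=
  ∀ (N : ℕ) (δ ρ K Λ a b cnd η Rw Rb cg : ℝ), 0 < N → 0 < δ → 0 < ρ → 0 < η → 0 < Rw → 0 < Rb → 0 < cg → ∃ Γ₁ : ℝ, ∀ Γ : ℝ, Γ₁ ≤ Γ → ∀ (γ : (Fin N → ℝ) → Fin N → ℝ) (α : (Fin N → ℝ) → ℝ) (X : (Fin N → ℝ) → Fin N → ℝ → EuclideanSpace ℝ (Fin 3)) (w : (Fin N → ℝ) → Fin N → ℝ → ℝ) (c : (Fin N → ℝ) → Fin N → ℝ) (m n : (Fin N → ℝ) → Fin N → EuclideanSpace ℝ (Fin 3)) (u : (Fin N → ℝ) → (Fin N → ℝ → EuclideanSpace ℝ (Fin 3)) → EuclideanSpace ℝ (Fin 3) → EuclideanSpace ℝ (Fin 3)) (v : (Fin N → ℝ) → EuclideanSpace ℝ (Fin 3) → EuclideanSpace ℝ (Fin 3)) (A : (Fin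 N → ℝ) → Fin N → (EuclideanSpace ℝ (Fin 3) →L[ℝ] EuclideanSpace ℝ (Fin 3))) (T : (Fin N → ℝ) → (Fin N → ℝ → EuclideanSpace ℝ (Fin 3)) → Fin N → ℝ → EuclideanSpace ℝ (Fin 3)) (D : (Fin N → ℝ) → Fin N → EuclideanSpace ℝ (Fin 3) → EuclideanSpace ℝ (Fin 3)), (∀ p Z y, u p Z y = ∑ k : Fin N, (Γ * γ p k / (4 * Real.pi)) • ∫ σ : ℝ, ((‖y - Z k σ‖ ^ 2 + 1) ^ (3 / 2 : ℝ))⁻¹ • Literature.Analysis.FluidPDE.cross (deriv (Z k) σ) (y - Z k σ)) → (∀ p y, v p y = u p (X p) y + (1 / 2 : ℝ) • y - α p • Literature.Analysis.FluidPDE.cross (EuclideanSpace.single (2 : Fin 3) (1 : ℝ)) y) → (∀ p j, A p j = fderiv ℝ (v p) (X p j (c p j))) → (∀ p Z j τ, T p Z j τ = (u p Z (Z j τ) + (1 / 2 : ℝ) • Z j τ - α p • Literature.Analysis.FluidPDE.cross (EuclideanSpace.single (2 : Fin 3) (1 : ℝ)) (Z j τ)) - (inner ℝ (u p Z (Z j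 τ) + (1 / 2 : ℝ) • Z j τ - α p • Literature.Analysis.FluidPDE.cross (EuclideanSpace.single (2 : Fin 3) (1 : ℝ)) (Z j τ)) (deriv (Z j) τ) / ‖deriv (Z j) τ‖ ^ 2) • deriv (Z j) τ) → (∀ p j y, D p j y = (Real.exp (-(inner ℝ (y - X p j (c p j)) (deriv (X p j) (c p j))) ^ 2) * ((1 - Real.exp (-(‖y - X p j (c p j)‖ ^ 2 - inner ℝ (y - X p j (c p j)) (deriv (X p j) (c p j)) ^ 2))) / (‖y - X p j (c p j)‖ ^ 2 - inner ℝ (y - X p j (c p j)) (deriv (X p j) (c p j)) ^ 2))) • Literature.Analysis.FluidPDE.cross (deriv (X p j) (c p j)) (y - X p j (c p j))) → ((∀ j, ContinuousOn (fun q : (Fin N → ℝ) × ℝ => (α q.1, γ q.1 j, X q.1 j q.2, w q.1 j q.2)) ({p : Fin N → ℝ | ∀ i, p i ∈ Set.Icc (0:ℝ) 1} ×ˢ Set.univ)) ∧ (∀ p : Fin N → ℝ, (∀ i, p i ∈ Set.Icc (0:ℝ) 1) → α p ≠ 0 ∧ (∀ j, γ p j ≠ 0) ∧ (∀ j, ContDiff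 ℝ 2 (X p j) ∧ Differentiable ℝ (w p j) ∧ (∀ τ, ‖deriv (X p j) τ‖ = 1) ∧ (∀ τ, ‖iteratedDeriv 2 (X p j) τ‖ * Real.sqrt Γ ≤ K) ∧ Filter.Tendsto (fun τ => ‖X p j τ‖) (Filter.cocompact ℝ) Filter.atTop) ∧ (∀ j k, j ≠ k → ∀ τ σ, ρ * Real.sqrt Γ ≤ ‖X p j τ - X p k σ‖) ∧ (∀ j τ σ, ρ * Real.sqrt Γ ≤ |τ - σ| → cg * ρ * Real.sqrt Γ ≤ ‖X p j τ - X p j σ‖) ∧ (∀ j τ, cg * |τ - c p j| ≤ Rw * Real.sqrt Γ + ‖X p j τ‖) ∧ (∀ j τ, w p j τ = inner ℝ (v p (X p j τ)) (deriv (X p j) τ)) ∧ (∀ j τ, ‖X p j τ‖ ≤ Rb * Real.sqrt (Γ * Real.log Γ) → v p (X p j τ) = w p j τ • deriv (X p j) τ) ∧ (∀ j, ‖X p j (c p j)‖ ≤ Rw * Real.sqrt Γ) ∧ (∀ j, w p j (c p j) = 0 ∧ (∀ τ, w p j τ = 0 → τ = c p j) ∧ 3 / 2 + δ ≤ deriv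 (w p j) (c p j) ∧ deriv (w p j) (c p j) ≤ Λ) ∧ (∀ j, Orthonormal ℝ ![deriv (X p j) (c p j), m p j, n p j] ∧ inner ℝ (A p j (m p j)) (m p j) + inner ℝ (A p j (n p j)) (n p j) < 0 ∧ inner ℝ (A p j (n p j)) (m p j) * inner ℝ (A p j (m p j)) (n p j) < inner ℝ (A p j (m p j)) (m p j) * inner ℝ (A p j (n p j)) (n p j)) ∧ (∀ Y : Fin N → ℝ → EuclideanSpace ℝ (Fin 3), (∀ j, ContDiff ℝ 2 (Y j)) → (∀ j τ, inner ℝ (Y j τ) (deriv (X p j) τ) = 0) → ∑ j : Fin N, inner ℝ (Y j (c p j)) (Literature.Analysis.FluidPDE.cross (EuclideanSpace.single (2 : Fin 3) (1 : ℝ)) (X p j (c p j))) = 0 → (∀ j τ, ‖Y j τ‖ + ‖deriv (Y j) τ‖ + ‖iteratedDeriv 2 (Y j) τ‖ ≤ (1 + |τ - c p j|) ^ b) → ∀ L : ℝ, (∀ j τ, ‖deriv (fun s : ℝ => T p (fun k σ => X p k σ + s • Y k σ) j τ) 0‖ ≤ L * (1 + |τ - c p j|) ^ a) → ∀ j τ,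 ‖Y j τ‖ ≤ cnd * L * (1 + |τ - c p j|) ^ b))) → ∃ (C₀ M : ℝ) (U : (Fin N → ℝ) → EuclideanSpace ℝ (Fin 3) → EuclideanSpace ℝ (Fin 3)) (P : (Fin N → ℝ) → EuclideanSpace ℝ (Fin 3) → ℝ) (B : (Fin N → ℝ) → Fin N → ℝ), (ContinuousOn B {p : Fin N → ℝ | ∀ i, p i ∈ Set.Icc (0:ℝ) 1} ∧ ∀ p : Fin N → ℝ, (∀ i, p i ∈ Set.Icc (0:ℝ) 1) → U p ≠ 0 ∧ ContDiff ℝ (⊤ : ℕ∞) (U p) ∧ ContDiff ℝ (⊤ : ℕ∞) (P p) ∧ Literature.Analysis.FluidPDE.VectorCalculus.IsDivFree (U p) ∧ (∀ y, α p • (Literature.Analysis.FluidPDE.cross (EuclideanSpace.single (2 : Fin 3) (1 : ℝ)) (U p y) - fderiv ℝ (U p) y (Literature.Analysis.FluidPDE.cross (EuclideanSpace.single (2 : Fin 3) (1 : ℝ)) y)) + (1 / 2 : ℝ) • U p y + (1 / 2 : ℝ) • fderiv ℝ (U p) y y - (Laplacian.laplacian (U p)) y + fderiv ℝ (U p) y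 (U p y) + gradient (P p) y = ∑ j : Fin N, B p j • D p j y) ∧ (∀ y, ‖U p y‖ ≤ C₀ / (1 + ‖y‖)) ∧ (∀ y, |P p y| ≤ M) ∧ (∀ y, ‖y‖ ≤ Rw * Real.sqrt Γ → (∀ j τ, ρ * Real.sqrt Γ / 4 ≤ ‖y - X p j τ‖) → ‖U p y - u p (X p) y‖ ≤ η * Real.sqrt Γ))

/-- **Proposed rev-6 statement of stmt-NavierStokesRegularity-17944**: the nonlinear gluing GIVEN the linear
input, with the quantitative box as hypothesis — `CoreLinearInvertibility → TransverseReduction`. -/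
def CoreGluingGivenInvertibilityQ : Prop :=
  CoreLinearInvertibility → TransverseReduction

/-- rev-6 glue to the TARGET: box + quantitative gluing-given-invertibility + linear lemma ⇒ `RssProfileExists`
(via the landed s1 glue `rssProfileExists_of_selectionBox_transverseReduction`, p153006). -/
theorem rssProfileExists_of_rev6 (hSB : SelectionBox) (hQ : CoreGluingGivenInvertibilityQ)
    (hL : CoreLinearInvertibility) : RssProfileExists :=
  rssProfileExists_of_selectionBox_transverseReduction hSB (hQ hL)

/-- rev-6 glue to the CRUX as typed: `SelectionBox → CoreGluingGivenInvertibilityQ → CoreLinearInvertibility → CoreGluing`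
(the hypothesis `SkeletonEquilibrium` is never consumed). -/
theorem coreGluing_of_rev6 (hSB : SelectionBox) (hQ : CoreGluingGivenInvertibilityQ)
    (hL : CoreLinearInvertibility) : CoreGluing :=
  stub_coreGluingSplit hSB (hQ hL)

/-- The rev-6 item implies the rev-5 item: `SelectionBox → CoreGluingGivenInvertibilityQ → CoreGluingGivenInvertibility`
— restating stmt-17944 to the quantitative form loses nothing for the route. -/
theorem coreGluingGivenInvertibility_of_rev6 (hSB : SelectionBox) (hQ : CoreGluingGivenInvertibilityQ) :
    CoreGluingGivenInvertibility :=
  fun hL => coreGluing_of_rev6 hSB hQ hL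

/-- rev-6 deciding theorem (shape for `--closes-file`): the four would-be items give `¬ NavierStokesRegularity`;
the body is the tree theorem `rssProfileExists_not_navierStokesRegularity` (p134409), which already discharges the
bridge `RdssProfileTruncation` (stmt-11289, proved) — so `hT` is not even used. -/
theorem closes_rev6 (hSB : SelectionBox) (hL : CoreLinearInvertibility) (hQ : CoreGluingGivenInvertibilityQ)
    (_hT : RdssProfileTruncation) : ¬ _root_.NavierStokesRegularity :=
  rssProfileExists_not_navierStokesRegularity (rssProfileExists_of_rev6 hSB hQ hL)

/-- Sanity: the rev-5 composition is the tree theorem `Theorems.coreGluing_of_invertibility_split` (p151377):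
`CoreLinearInvertibility → CoreGluingGivenInvertibility → CoreGluing`. -/
theorem coreGluing_of_rev5 (hL : CoreLinearInvertibility) (hK2 : CoreGluingGivenInvertibility) : CoreGluing :=
  coreGluing_of_invertibility_split hL hK2

end Summit.NavierStokesRegularity.NavierStokesRegularity.Cruxes.CoreGluing.RestatementC12
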